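import Summits.QuantumFields.YangMills.Theorems.UnitScaleTiltProp7SectET3WCurrentProp4RowsT3
import Literature.MathematicalPhysics.QuantumFieldTheory.Balaban1983to89.B11Eq63V0GroupCurrent
import Literature.MathematicalPhysics.QuantumFieldTheory.Balaban1983to89.MatrixNorms
import HarnessLib

/-!
# Route `UnitScaleTilt`, crux «MinimiserStabilityRegPr» (stmt-QuantumFields-19200, stub EX `stub_existenceMinimalOrbit`), route (α), node N06(d = 3) —
# **«HQV-MTAU»: THE V₀-SLOT ROW `hqV` OF lit ✓`quadAnalytic_W80_composite` AT THE (W-X′) LETTER OF RECORD `τ₂ := tr` (UN-NORMALISED TRACE), BY τ-HOMOGENEITY OF THE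
# V₀-GROUP CURRENT** — `curV0 ρ (c•τ) U₀ = c • curV0 ρ τ U₀` ([Balaban1985Variational] (90)–(96): every term of `(δ∕δA′)V₀` carries exactly one trace), so ★px3's
# ✓`hqV_bgOfCfg_of_regPr` (contractive `τ`) transports to any `τ` with `‖τ X‖ ≤ M_τ‖X‖` at the cost `C_V ↦ M_τ·C_V`; at `tr` on `M₂(ℂ)`, `M_τ = 2`.

Cell `ym3-torus` (HUMAN RULING D-0037, YM ladder rung R3 — YM₃ on T³ is a rung, NOT d = 4, NOT a mass gap, NOT Clay; YM gap NOT proved), width seat `ym3-torus-px19` (gen 4).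
THEOREMS ONLY (0 `def`, 0 `sorry`); `--supports stmt-QuantumFields-19200 --as helper`; count-neutral; NO claim on crux ∕ stub ∕ registry.  Nothing of [Balaban1985Variational] is asserted
beyond what ✓p664073 already proves: §1 is algebra on lit's definitions (`rem3`, `term39`, `V0p`, `V0primeP`, `dV0primeBond`, `dTerm39Bond`, `curV0prime`, `curComm`, `curV0`), §2–§3 rescale.

WHY (★px5 g3 PROP4-W80 SNAG 2, 2026-08-29T00:41:13Z).  The door on lit ✓`quadAnalytic_W80_composite` needs `hqV : ‖Y‖ < R_V → ‖curV0 ρ₂ τ₂ (bgOfCfg U₀) Y‖ ≤ C_V‖Y‖²` at the letter of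
record `τ₂ := LinearMap.toContinuousLinearMap (Matrix.traceLinearMap (Fin 2) ℂ ℂ)`; ✓p664073 `hqV_bgOfCfg_of_regPr` asks `hτ1 : ‖τ X‖ ≤ ‖X‖`, false for `tr` in the L2-operator norm
(`‖tr 1‖ = 2`).  THIS FILE removes the snag with zero Literature edits.

WHAT IS PROVED (ns `…Theorems.Prop7HqVOfTraceBound`).
* §1 (generic carriers, [folklore] algebra) `rem3_smul`, `term39_smul`, `V0p_smul`, `V0primeP_smul` — `·(c•τ) = c·(·τ)`; ★`dV0primeBond_smul`, ★`dTerm39Bond_smul` — the one-bond functionals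
  scale (`deriv_const_mul_field`); ★`curV0prime_smul`, ★`curComm_smul`, ★★`curV0_smul` — `curV0 ρ (c • τ) U₀ Y = c • curV0 ρ τ U₀ Y`.
* §2 ★★`hqV_bgOfCfg_of_regPr_of_norm_le` — ✓p664073's row with `hτ1` replaced by `hτM : ∀ X, ‖τ X‖ ≤ M_τ‖X‖` (`0 < M_τ`), constant `M_τ·(1024·2·M_ρ·(ε₀ + 1∕16) + 2·138·M_ρ)`, radius
  `1∕16` (apply p664073 to `τ′ := M_τ⁻¹•τ`, tracial ∕ ⋆-compatible ∕ contractive, then `curV0_smul`).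
* §3 `trace_mul_comm_clm`, `trace_star_clm`, `norm_trace_clm_le` — the three `τ`-rows of the letter of record `τ₂` (`M_τ = 2`, lit `MatrixNorms.norm_ntr_le_opNorm`);
  ★★`hqV_bgOfCfg_of_regPr_trace` — THE ROW AT THE LETTER OF RECORD: `‖curV0 ρ τ₂ (bgOfCfg F K U₀) Y‖ ≤ 2·(1024·2·M_ρ·(ε₀ + 1∕16) + 2·138·M_ρ)·‖Y‖²` on `‖Y‖ < 1∕16`, `RegPr F n K ε₀ U₀`,
  `‖ρ ℓ‖ ≤ M_ρ‖ℓ‖`; `hqV_bgOfCfg_of_regPr_trace_family` — the family shape over `Idx L` at `ε₀ := ρ ≤ α L` with `C_V L := 2·(2048·M_ρ·(α L + 1∕16) + 276·M_ρ)`.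
HONEST SCOPE: no new estimate; `ρ`'s row `hρ` stays a hypothesis (★px3 ✓p680179 `hρ_rieszτ_frobEquiv`-class supplies it at `ρ₂ := rieszτ frobEquiv`); nothing of the stub ∕ crux claimed.
References: T. Bałaban, CMP 102 (1985) 277–309 [Balaban1985Variational] ((39) p.284, (63) p.287, (90)–(96) pp.291–292, Prop. 4 (98) p.293); CMP 99 (1985) 389–434 [Balaban1985BackgroundPropagators]
((3.12) p.392, (3.35) p.396).
-/

set_option autoImplicit false

noncomputable section

open scoped Matrix.Norms.L2Operator BigOperators ComplexConjugate

namespace Summit.QuantumFields.YangMills.Theorems.Prop7HqVOfTraceBound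

open Literature.MathematicalPhysics.QuantumFieldTheory.Balaban1983to89
open Literature.MathematicalPhysics.QuantumFieldTheory.Balaban1983to89.T3ContinuumYM3Torus
open Literature.MathematicalPhysics.QuantumFieldTheory.Balaban1983to89.T3Thm1Carrier (Idx)
open Literature.MathematicalPhysics.QuantumFieldTheory.Balaban1983to89.T3PrintedRegularMinimiser (RegPr)
open Literature.MathematicalPhysics.QuantumFieldTheory.Balaban1983to89.T3PrintedMinimiserExistence (regPr_mono)
open Literature.MathematicalPhysics.QuantumFieldTheory.Balaban1983to89.B9Eq39Adjoint (rem3)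
open Literature.MathematicalPhysics.QuantumFieldTheory.Balaban1983to89.B11Eq26ActionExpansion (V0p)
open Literature.MathematicalPhysics.QuantumFieldTheory.Balaban1983to89.B11Eq90V0primeBond (term39 V0primeP dV0primeBond dV0primeBond_apply)
open Literature.MathematicalPhysics.QuantumFieldTheory.Balaban1983to89.B11Eq92CommutatorFunctional (dTerm39Bond dTerm39Bond_apply)
open Literature.MathematicalPhysics.QuantumFieldTheory.Balaban1983to89.B11Eq90V0primeCurrent (Tsh Ucur curL curV0prime curV0prime_apply)
open Literature.MathematicalPhysics.QuantumFieldTheory.Balaban1983to89.B11Eq96CommutatorCurrent (curComm curComm_apply)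
open Literature.MathematicalPhysics.QuantumFieldTheory.Balaban1983to89.B11Eq63V0GroupCurrent (curV0)
open B9SectCLatticeCarrier (Bond)
open B4Sect5Torus (TSite)
open B11Eq115Space (NegSize Space115 JetSup NegSup levWeight)
open B11Eq111FrakG (nabla115)
open Summit.QuantumFields.YangMills.Theorems.Prop7SectET3Transport (periodsT3 bgOfCfg)
open Summit.QuantumFields.YangMills.Theorems.Prop7SectET3WCurrentProp4Rows (hqV_bgOfCfg_of_regPr)

/-! ## §1 τ-homogeneity of the V₀-group current (generic carriers) -/

section Homogeneity

variable {𝔸 : Type*} [NormedRing 𝔸] [NormedAlgebra ℂ 𝔸] [CompleteSpace 𝔸]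

section PerPlaquette

variable {S : Type*} [Fintype S] [DecidableEq S] {ι : Type*} [Fintype ι] [LinearOrder ι] (T : ι → Equiv.Perm S) (U : ι → S → 𝔸ˣ)

omit [CompleteSpace 𝔸] [Fintype S] [DecidableEq S] [Fintype ι] [LinearOrder ι] in
/-- The third-order plaquette remainder `ρ_p` carries exactly one trace: `rem3 η (c•τ) = c·rem3 η τ`. [folklore] [cite: Balaban1985BackgroundPropagators, (3.12) p.392] -/
theorem rem3_smul (η : ℝ) (c : ℂ) (τ : 𝔸 →ₗ[ℂ] ℂ) (A : ι → S → 𝔸) (μ ν : ι) (x : S) :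
    rem3 T U η (c • τ) A μ ν x = c * rem3 T U η τ A μ ν x := by
  simp only [rem3, LinearMap.smul_apply, smul_eq_mul]; ring

omit [CompleteSpace 𝔸] [Fintype S] [DecidableEq S] [Fintype ι] [LinearOrder ι] in
/-- The (39)-term carries exactly one trace: `term39 η (c•τ) = c·term39 η τ`. [folklore] [cite: Balaban1985Variational, (39) p.284] -/
theorem term39_smul (η : ℝ) (c : ℂ) (τ : 𝔸 →ₗ[ℂ] ℂ) (A : ι → S → 𝔸) (μ ν : ι) (x : S) :
    term39 T U η (c • τ) A μ ν x = c * term39 T U η τ A μ ν x := by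
  simp only [term39, LinearMap.smul_apply, smul_eq_mul]; ring

omit [CompleteSpace 𝔸] [Fintype S] [DecidableEq S] [Fintype ι] [LinearOrder ι] in
/-- `V₀(A, ∂p)` carries exactly one trace: `V0p η (c•τ) = c·V0p η τ`. [folklore] [cite: Balaban1985Variational, (30) p.282] -/
theorem V0p_smul (η : ℝ) (c : ℂ) (τ : 𝔸 →ₗ[ℂ] ℂ) (A : ι → S → 𝔸) (μ ν : ι) (x : S) :
    V0p T U η (c • τ) A μ ν x = c * V0p T U η τ A μ ν x := by
  rw [V0p, V0p, rem3_smul]; ring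

omit [CompleteSpace 𝔸] [Fintype S] [DecidableEq S] [Fintype ι] [LinearOrder ι] in
/-- `V′₀(A, ∂p)` carries exactly one trace: `V0primeP η (c•τ) = c·V0primeP η τ`. [folklore] [cite: Balaban1985Variational, (39) p.284] -/
theorem V0primeP_smul (η : ℝ) (c : ℂ) (τ : 𝔸 →ₗ[ℂ] ℂ) (A : ι → S → 𝔸) (μ ν : ι) (x : S) :
    V0primeP T U η (c • τ) A μ ν x = c * V0primeP T U η τ A μ ν x := by
  rw [V0primeP, V0primeP, V0p_smul, term39_smul]; ring

/-- ★ **The one-bond functional of `V′₀` scales with the trace**: `dV0primeBond η (c•τ) = c • dV0primeBond η τ` ((63): it is the line derivative of `V′₀`, homogeneous in `τ`).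
[folklore] [cite: Balaban1985Variational, (63) p.287, (90) p.291] -/
theorem dV0primeBond_smul (η : ℝ) (c : ℂ) (τ : 𝔸 →L[ℂ] ℂ) (A : ι → S → 𝔸) (q : S × ι × ι) (μ₀ : ι) (x₀ : S) :
    dV0primeBond T U η (c • τ) A q μ₀ x₀ = c • dV0primeBond T U η τ A q μ₀ x₀ := by
  ext X
  rw [dV0primeBond_apply, smul_apply, dV0primeBond_apply, ContinuousLinearMap.toLinearMap_smul, smul_eq_mul]
  simp only [V0primeP_smul]
  exact deriv_const_mul_field c

omit [CompleteSpace 𝔸] in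
/-- ★ **The one-bond functional of the (39)-term scales with the trace**: `dTerm39Bond η (c•τ) = c • dTerm39Bond η τ`. [folklore] [cite: Balaban1985Variational, (63) p.287, (93) p.292] -/
theorem dTerm39Bond_smul (η : ℝ) (c : ℂ) (τ : 𝔸 →L[ℂ] ℂ) (A : ι → S → 𝔸) (q : S × ι × ι) (μ₀ : ι) (x₀ : S) :
    dTerm39Bond T U η (c • τ) A q μ₀ x₀ = c • dTerm39Bond T U η τ A q μ₀ x₀ := by
  ext X
  rw [dTerm39Bond_apply, smul_apply, dTerm39Bond_apply, ContinuousLinearMap.toLinearMap_smul, smul_eq_mul]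
  simp only [term39_smul]
  exact deriv_const_mul_field c

end PerPlaquette

section Current

variable {d : ℕ} {Pd : Fin d → ℕ} {L η : ℝ} [Fact (0 < L)] [Fact (0 < η)] {lev₀ : Bond d Pd → ℕ}
  {κ' : Type*} [Fintype κ'] {lev₁ : κ' → ℕ} {Dc : (Bond d Pd → 𝔸) →ₗ[ℂ] (κ' → 𝔸)}

omit [Fact (0 < L)] [Fact (0 < η)] [Fintype κ'] in
/-- ★ **The V′₀-current scales with the trace**: `curV0prime ρ (c•τ) U₀ Y = c • curV0prime ρ τ U₀ Y` ((90): a sum of `ρ` of one-bond functionals, `ρ` linear).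
[folklore] [cite: Balaban1985Variational, (90) p.291] -/
theorem curV0prime_smul (ρ : (𝔸 →L[ℂ] ℂ) →L[ℂ] 𝔸) (c : ℂ) (τ : 𝔸 →L[ℂ] ℂ) (U₀ : Bond d Pd → 𝔸ˣ) (Y : Space115 L η lev₀ lev₁ Dc) :
    curV0prime (lev₁ := lev₁) (Dc := Dc) ρ (c • τ) U₀ Y = c • curV0prime (lev₁ := lev₁) (Dc := Dc) ρ τ U₀ Y := by
  apply (NegSup.equiv (levWeight L η lev₀ 3) 𝔸).injective
  funext b
  rw [NegSup.equiv_smul, Pi.smul_apply, curV0prime_apply, curV0prime_apply, Finset.smul_sum]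
  refine Finset.sum_congr rfl fun q _ => ?_
  rw [dV0primeBond_smul, map_smul]

omit [CompleteSpace 𝔸] [Fact (0 < L)] [Fact (0 < η)] [Fintype κ'] in
/-- ★ **The commutator-group current scales with the trace**: `curComm ρ (c•τ) U₀ Y = c • curComm ρ τ U₀ Y` ((93)–(96)). [folklore] [cite: Balaban1985Variational, (93) p.292] -/
theorem curComm_smul (ρ : (𝔸 →L[ℂ] ℂ) →L[ℂ] 𝔸) (c : ℂ) (τ : 𝔸 →L[ℂ] ℂ) (U₀ : Bond d Pd → 𝔸ˣ) (Y : Space115 L η lev₀ lev₁ Dc) :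
    curComm (lev₁ := lev₁) (Dc := Dc) ρ (c • τ) U₀ Y = c • curComm (lev₁ := lev₁) (Dc := Dc) ρ τ U₀ Y := by
  apply (NegSup.equiv (levWeight L η lev₀ 3) 𝔸).injective
  funext b
  rw [NegSup.equiv_smul, Pi.smul_apply, curComm_apply, curComm_apply, Finset.smul_sum]
  refine Finset.sum_congr rfl fun q _ => ?_
  rw [dTerm39Bond_smul, map_smul]

omit [Fact (0 < L)] [Fact (0 < η)] [Fintype κ'] in
/-- ★★ **THE V₀-GROUP CURRENT IS HOMOGENEOUS OF DEGREE ONE IN THE TRACE LETTER**: `curV0 ρ (c • τ) U₀ Y = c • curV0 ρ τ U₀ Y` — every term of `(δ∕δA′)V₀` ((90)–(96)) carries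
exactly one `τ`. [folklore] [cite: Balaban1985Variational, (90)–(96) pp.291–292] -/
theorem curV0_smul (ρ : (𝔸 →L[ℂ] ℂ) →L[ℂ] 𝔸) (c : ℂ) (τ : 𝔸 →L[ℂ] ℂ) (U₀ : Bond d Pd → 𝔸ˣ) (Y : Space115 L η lev₀ lev₁ Dc) :
    curV0 (lev₁ := lev₁) (Dc := Dc) ρ (c • τ) U₀ Y = c • curV0 (lev₁ := lev₁) (Dc := Dc) ρ τ U₀ Y := by
  rw [curV0, curV0, curV0prime_smul, curComm_smul, smul_add]

end Current

end Homogeneity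

/-! ## §2 The row for a trace letter of norm `≤ M_τ` -/

section Row

variable (F : T3Family) {n K : ℕ} [Fact (0 < (F.L : ℝ))] [Fact (0 < ((F.L : ℝ)⁻¹) ^ (K - n))]

/-- ★★ **`hqV` AT THE BACKGROUND OF RECORD FOR A TRACIAL ⋆-COMPATIBLE TRACE LETTER OF NORM `≤ M_τ`** (✓p664073 `hqV_bgOfCfg_of_regPr` with `hτ1` relaxed to `‖τ X‖ ≤ M_τ‖X‖`):
`‖curV0 ρ τ (bgOfCfg F K U₀) Y‖ ≤ M_τ·(1024·2·M_ρ·(ε₀ + 1∕16) + 2·138·M_ρ)·‖Y‖²` on `‖Y‖ < 1∕16`, `RegPr F n K ε₀ U₀` — the contractive letter `τ′ := M_τ⁻¹•τ` and §1's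
homogeneity `curV0 ρ τ = M_τ • curV0 ρ τ′`. [cite: Balaban1985Variational, (90)–(96) pp.291–292, Prop. 4 (98) p.293; Balaban1985BackgroundPropagators, (3.35) p.396] -/
theorem hqV_bgOfCfg_of_regPr_of_norm_le (ρ : (Matrix (Fin 2) (Fin 2) ℂ →L[ℂ] ℂ) →L[ℂ] Matrix (Fin 2) (Fin 2) ℂ) (τ : Matrix (Fin 2) (Fin 2) ℂ →L[ℂ] ℂ)
    (hτ : ∀ a b : Matrix (Fin 2) (Fin 2) ℂ, τ (a * b) = τ (b * a)) (hτs : ∀ a : Matrix (Fin 2) (Fin 2) ℂ, τ (star a) = starRingEnd ℂ (τ a))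
    {Mτ : ℝ} (hMτ : 0 < Mτ) (hτM : ∀ X : Matrix (Fin 2) (Fin 2) ℂ, ‖τ X‖ ≤ Mτ * ‖X‖) {Mρ : ℝ} (hMρ : 0 ≤ Mρ)
    (hρ : ∀ ℓ : Matrix (Fin 2) (Fin 2) ℂ →L[ℂ] ℂ, ‖ρ ℓ‖ ≤ Mρ * ‖ℓ‖) {ε₀ : ℝ} (hε₀ : 0 ≤ ε₀)
    (U₀ : GaugeField (F.P K) 0 (Matrix.specialUnitaryGroup (Fin 2) ℂ)) (hreg : RegPr F n K ε₀ U₀)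
    (Y : Space115 (F.L : ℝ) (((F.L : ℝ)⁻¹) ^ (K - n)) (fun _ : Bond 3 (periodsT3 F K) => K - n)
        (fun _ : Bond 3 (periodsT3 F K) × Fin 3 => K - n) (nabla115 (((F.L : ℝ)⁻¹) ^ (K - n)) (bgOfCfg F K U₀))) (hY : ‖Y‖ < 1 / 16) :
    ‖curV0 (lev₁ := fun _ : Bond 3 (periodsT3 F K) × Fin 3 => K - n) (Dc := nabla115 (((F.L : ℝ)⁻¹) ^ (K - n)) (bgOfCfg F K U₀)) ρ τ (bgOfCfg F K U₀) Y‖ ≤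
      Mτ * (1024 * ((3 - 1 : ℕ) : ℝ) * Mρ * (ε₀ + 1 / 16) + ((3 - 1 : ℕ) : ℝ) * 138 * Mρ) * ‖Y‖ ^ 2 := by
  have hM0 : (Mτ : ℂ) ≠ 0 := Complex.ofReal_ne_zero.mpr hMτ.ne'
  -- the contractive letter `τ′ := M_τ⁻¹ • τ`
  set τ' : Matrix (Fin 2) (Fin 2) ℂ →L[ℂ] ℂ := ((Mτ : ℂ)⁻¹) • τ with hτ'def
  have hτeq : τ = (Mτ : ℂ) • τ' := by
    rw [hτ'def, smul_smul, mul_inv_cancel₀ hM0, one_smul]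
  have hτ' : ∀ a b : Matrix (Fin 2) (Fin 2) ℂ, τ' (a * b) = τ' (b * a) := fun a b => by
    simp only [hτ'def, smul_apply, hτ a b]
  have hτ's : ∀ a : Matrix (Fin 2) (Fin 2) ℂ, τ' (star a) = starRingEnd ℂ (τ' a) := fun a => by
    simp only [hτ'def, smul_apply, hτs a, smul_eq_mul, map_mul, map_inv₀, Complex.conj_ofReal]
  have hτ'1 : ∀ X : Matrix (Fin 2) (Fin 2) ℂ, ‖τ' X‖ ≤ ‖X‖ := fun X => by
    rw [hτ'def, smul_apply, norm_smul, norm_inv, Complex.norm_real, Real.norm_of_nonneg hMτ.le]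
    calc Mτ⁻¹ * ‖τ X‖ ≤ Mτ⁻¹ * (Mτ * ‖X‖) := mul_le_mul_of_nonneg_left (hτM X) (inv_nonneg.2 hMτ.le)
      _ = ‖X‖ := by rw [← mul_assoc, inv_mul_cancel₀ hMτ.ne', one_mul]
  have key := hqV_bgOfCfg_of_regPr F ρ τ' hτ' hτ's hτ'1 hMρ hρ hε₀ U₀ hreg Y hY
  rw [hτeq, curV0_smul, norm_smul, Complex.norm_real, Real.norm_of_nonneg hMτ.le, mul_assoc]
  exact mul_le_mul_of_nonneg_left key hMτ.le

end Row

/-! ## §3 The letter of record `τ₂ := tr` on `M₂(ℂ)`: `M_τ = 2` -/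

/-- `tr(ab) = tr(ba)` for the trace letter of record. [folklore] -/
theorem trace_mul_comm_clm (a b : Matrix (Fin 2) (Fin 2) ℂ) :
    LinearMap.toContinuousLinearMap (Matrix.traceLinearMap (Fin 2) ℂ ℂ) (a * b) = LinearMap.toContinuousLinearMap (Matrix.traceLinearMap (Fin 2) ℂ ℂ) (b * a) := by
  simp only [LinearMap.coe_toContinuousLinearMap', Matrix.traceLinearMap_apply]
  exact Matrix.trace_mul_comm a b

/-- `tr(a*) = conj (tr a)` for the trace letter of record. [folklore] -/
theorem trace_star_clm (a : Matrix (Fin 2) (Fin 2) ℂ) :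
    LinearMap.toContinuousLinearMap (Matrix.traceLinearMap (Fin 2) ℂ ℂ) (star a) = starRingEnd ℂ (LinearMap.toContinuousLinearMap (Matrix.traceLinearMap (Fin 2) ℂ ℂ) a) := by
  simp only [LinearMap.coe_toContinuousLinearMap', Matrix.traceLinearMap_apply]
  rw [Matrix.star_eq_conjTranspose, Matrix.trace_conjTranspose]
  rfl

/-- `‖tr X‖ ≤ 2‖X‖` in the L2-operator norm on `M₂(ℂ)` (lit `MatrixNorms.norm_ntr_le_opNorm`: the NORMALISED trace is contractive). [folklore] -/
theorem norm_trace_clm_le (X : Matrix (Fin 2) (Fin 2) ℂ) :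
    ‖LinearMap.toContinuousLinearMap (Matrix.traceLinearMap (Fin 2) ℂ ℂ) X‖ ≤ 2 * ‖X‖ := by
  simp only [LinearMap.coe_toContinuousLinearMap', Matrix.traceLinearMap_apply]
  have h := MatrixNorms.norm_ntr_le_opNorm X
  rw [MatrixNorms.ntr, Fintype.card_fin, norm_div, Nat.cast_ofNat, Complex.norm_ofNat] at h
  linarith [div_le_iff₀ (by norm_num : (0:ℝ) < 2) |>.mp h]

section Record

variable (F : T3Family) {n K : ℕ} [Fact (0 < (F.L : ℝ))] [Fact (0 < ((F.L : ℝ)⁻¹) ^ (K - n))]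

/-- ★★ **`hqV` AT THE (W-X′) LETTER OF RECORD `τ₂ := tr`** (★px5 g3 PROP4-W80 SNAG 2 removed): for a fibre letter `ρ` with `‖ρ ℓ‖ ≤ M_ρ‖ℓ‖`, on `RegPr F n K ε₀ U₀` (`ε₀ ≥ 0`) and the `1∕16`-ball,
`‖curV0 ρ tr (bgOfCfg F K U₀) Y‖ ≤ 2·(1024·2·M_ρ·(ε₀ + 1∕16) + 2·138·M_ρ)·‖Y‖²`. [cite: Balaban1985Variational, (90)–(96) pp.291–292, Prop. 4 (98) p.293; Balaban1985BackgroundPropagators, (3.35) p.396] -/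
theorem hqV_bgOfCfg_of_regPr_trace (ρ : (Matrix (Fin 2) (Fin 2) ℂ →L[ℂ] ℂ) →L[ℂ] Matrix (Fin 2) (Fin 2) ℂ) {Mρ : ℝ} (hMρ : 0 ≤ Mρ)
    (hρ : ∀ ℓ : Matrix (Fin 2) (Fin 2) ℂ →L[ℂ] ℂ, ‖ρ ℓ‖ ≤ Mρ * ‖ℓ‖) {ε₀ : ℝ} (hε₀ : 0 ≤ ε₀)
    (U₀ : GaugeField (F.P K) 0 (Matrix.specialUnitaryGroup (Fin 2) ℂ)) (hreg : RegPr F n K ε₀ U₀)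
    (Y : Space115 (F.L : ℝ) (((F.L : ℝ)⁻¹) ^ (K - n)) (fun _ : Bond 3 (periodsT3 F K) => K - n)
        (fun _ : Bond 3 (periodsT3 F K) × Fin 3 => K - n) (nabla115 (((F.L : ℝ)⁻¹) ^ (K - n)) (bgOfCfg F K U₀))) (hY : ‖Y‖ < 1 / 16) :
    ‖curV0 (lev₁ := fun _ : Bond 3 (periodsT3 F K) × Fin 3 => K - n) (Dc := nabla115 (((F.L : ℝ)⁻¹) ^ (K - n)) (bgOfCfg F K U₀)) ρ
        (LinearMap.toContinuousLinearMap (Matrix.traceLinearMap (Fin 2) ℂ ℂ)) (bgOfCfg F K U₀) Y‖ ≤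
      2 * (1024 * ((3 - 1 : ℕ) : ℝ) * Mρ * (ε₀ + 1 / 16) + ((3 - 1 : ℕ) : ℝ) * 138 * Mρ) * ‖Y‖ ^ 2 :=
  hqV_bgOfCfg_of_regPr_of_norm_le F ρ _ trace_mul_comm_clm trace_star_clm two_pos norm_trace_clm_le hMρ hρ hε₀ U₀ hreg Y hY

end Record

/-! ## §4 The family shape over the EX display's index -/

variable [hFL : ∀ F : T3Family, Fact (0 < (F.L : ℝ))] [hFη : ∀ (F : T3Family) (k : ℕ), Fact (0 < ((F.L : ℝ)⁻¹) ^ k)]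

/-- ★★ **`hqV` AT THE LETTER OF RECORD, FAMILY SHAPE**: for every member `(L, i, U₀)` with `RegPr ρ U₀`, `ρ ≤ α L` (`0 < α L`), and every `Y` in the `1∕16`-ball of the member's (115)-space,
`‖curV0 ρ₂ tr (bgOfCfg U₀) Y‖ ≤ C_V L·‖Y‖²` with `C_V L := 2·(1024·2·M_ρ·(α L + 1∕16) + 2·138·M_ρ)` — the display row the PROP4-W80 door reads as lit's `hqV` (after `regPr_mono` to `α L`).
[cite: Balaban1985Variational, (90)–(96) pp.291–292, Prop. 4 (98) p.293; Balaban1985BackgroundPropagators, (3.35) p.396] -/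
theorem hqV_bgOfCfg_of_regPr_trace_family {α : ℕ → ℝ} (hα : ∀ L, 1 < L → 0 < α L)
    (ρ₂ : (Matrix (Fin 2) (Fin 2) ℂ →L[ℂ] ℂ) →L[ℂ] Matrix (Fin 2) (Fin 2) ℂ) {Mρ : ℝ} (hMρ : 0 ≤ Mρ)
    (hρ : ∀ ℓ : Matrix (Fin 2) (Fin 2) ℂ →L[ℂ] ℂ, ‖ρ₂ ℓ‖ ≤ Mρ * ‖ℓ‖) :
    ∀ (L : ℕ), 1 < L → ∀ (i : Idx L) (ρ : ℝ) (U₀ : GaugeField (i.1.1.P i.1.2.2) 0 (Matrix.specialUnitaryGroup (Fin 2) ℂ)),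
      RegPr i.1.1 i.1.2.1 i.1.2.2 ρ U₀ → ρ ≤ α L →
      ∀ Y : Space115 (i.1.1.L : ℝ) (((i.1.1.L : ℝ)⁻¹) ^ (i.1.2.2 - i.1.2.1)) (fun _ : Bond 3 (periodsT3 i.1.1 i.1.2.2) => i.1.2.2 - i.1.2.1)
          (fun _ : Bond 3 (periodsT3 i.1.1 i.1.2.2) × Fin 3 => i.1.2.2 - i.1.2.1) (nabla115 (((i.1.1.L : ℝ)⁻¹) ^ (i.1.2.2 - i.1.2.1)) (bgOfCfg i.1.1 i.1.2.2 U₀)),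
        ‖Y‖ < 1 / 16 →
        ‖curV0 (lev₁ := fun _ : Bond 3 (periodsT3 i.1.1 i.1.2.2) × Fin 3 => i.1.2.2 - i.1.2.1) (Dc := nabla115 (((i.1.1.L : ℝ)⁻¹) ^ (i.1.2.2 - i.1.2.1)) (bgOfCfg i.1.1 i.1.2.2 U₀)) ρ₂
            (LinearMap.toContinuousLinearMap (Matrix.traceLinearMap (Fin 2) ℂ ℂ)) (bgOfCfg i.1.1 i.1.2.2 U₀) Y‖ ≤
          2 * (1024 * ((3 - 1 : ℕ) : ℝ) * Mρ * (α L + 1 / 16) + ((3 - 1 : ℕ) : ℝ) * 138 * Mρ) * ‖Y‖ ^ 2 := by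
  intro L hL i ρ U₀ hreg hρα Y hY
  exact hqV_bgOfCfg_of_regPr_trace i.1.1 ρ₂ hMρ hρ (hα L hL).le U₀ (regPr_mono i.1.1 hρα hreg) Y hY

end Summit.QuantumFields.YangMills.Theorems.Prop7HqVOfTraceBound

end
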